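import Summits.Ventures.Crystal3D.Theorems.StickyWulffConstantGenericWallFloorBarlowFamilyCountOneSided
import Summits.Ventures.Crystal3D.Theorems.StickyWulffConstantGenericWallFloorBarlowFamilyCountOneSidedTilt
import Summits.Ventures.Crystal3D.Theorems.StickyWulffConstantGenericWallFloorBarlowFamiliesApartTiltWide
import HarnessLib

/-!
# ONE steered zigzag family is paid (WIDE tilt ‖z − e₃‖ ≤ 1/3, constant of record): `#T₁ ≤ Σ_PAY (12 − deg)` (K1b / EDGE-ON option (ε), WIDE brick 5a)
# (lane T crux `TextureLiminfV5`, stmt-Ventures-23912, sub-crux EDGE-ON `stub_edgeOn`; HOME/wall-p2-g11/EPSILON-SIZING.md)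

HONEST FRAMING. Venture `Summits/Ventures/Crystal3D` (cell `crystal3d-full`), route `route-Ventures-StickyWulffConstant`, helper `--supports` the
law-v5 crux `TextureLiminfV5` (stmt-Ventures-23912), registered line `TexShadow` v8.3, open stub `stub_edgeOn` (K4).  Rung credit only; F-C1 not moved; NOT
the stub.  Inputs BY NAME: E1 (`hsE`, `hcert`), `DoubleStarCoaxialAt` / `CapPairCoaxial` (from `StarPairFar`).

THE POINT.  1/3 form of `barlowFamily_card_le_payers_oneSided_tilt` (p698183): the bottom plate's window family steered by a
unit `z` with ‖z − e₃‖ ≤ 1/3 (launch slot `v₁` steep FOR `z`, `∇`-cappers `bestCapper G (L₁ e₃) z`, chain frames `chainFrames z L₁ v₁` apart from plate 2's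
two lattices) is paid by the payer window: `bottomFamily_spec_apart_tiltWide` fed to lane G's frame-separated two-family count
`walkerFamilies_card_le_payers_sep` with vertical `z₁ = z`, an EMPTY second family, and the `z`-height bound of the cell
`⟪q, z⟫ ≤ h + 2R₀ + (ρ + h + 2R₀)/3` (tilt transfer `⟪q, z⟫ ≤ q₂ + ‖q‖/3`), whence the fuel hypothesis `8(h + 4R₀) + 6(ρ + h + 2R₀) < 3N`.
* **`barlowFamily_card_le_payers_oneSided_tiltWide`** — `#T₁ ≤ Σ_{y ∈ PAY} (12 − deg y)`, PAY = lane T's window `deg ≠ 12 ∧ −R₀ − 2 ≤ y₂ ≤ h + R₀ + 2`.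
WHAT THIS IS NOT: not the window LINES / lane T's `hlines` shape (brick 5b), not the stub; F-C1 not moved.
-/

noncomputable section

namespace Summit.Ventures.Crystal3D.Theorems

open Finset
open Literature.MathematicalPhysics.StatisticalMechanics
open Summit.Ventures.Crystal3D.Cruxes.TextureLiminf.TexShadow (stacking)
open scoped InnerProductSpace

variable {X : Finset (EuclideanSpace ℝ (Fin 3))}

open scoped Classical in
/-- **ONE steered Barlow zigzag family is paid by the payers, under clause (i) of `FramesApart` alone.**  The bottom plate `(L₁, s₀, σ₁)` (presented up
along `e₃`), a unit steering `z` with ‖z − e₃‖ ≤ 1/4, the walk data `v₁, canon₁, ms₁, δ₁` of `bottomFamily_spec_apart_tilt` (`v₁` an upper reference slot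
steep FOR `z`, in-plate steps rising `≥ δ₁` in `e₃`), the top plate only as the passive clamped sample, and `hapart₁`: no frame of `chainFrames z L₁ v₁`
carries `L₂·Λ₀` or its basal twin.  Then the window family `T₁` is paid: `#T₁ ≤ Σ_PAY (12 − deg)`. -/
theorem barlowFamily_card_le_payers_oneSided_tiltWide (hX : ∀ p ∈ X, ∀ q ∈ X, p ≠ q → 1 ≤ dist p q)
    {sE : EuclideanSpace ℝ (Fin 3)} (hsE : sE ∈ fccSlots) (hcert : ExactOnly 0 (fccSlots.filter fun w => 0 < ⟪w, sE⟫_ℝ))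
    (hDS : ∀ F₁ F₂ : EuclideanSpace ℝ (Fin 3) ≃ₗᵢ[ℝ] EuclideanSpace ℝ (Fin 3), DoubleStarCoaxialAt F₁ F₂) (hCP : CapPairCoaxial)
    -- the cell
    {σ₁ σ₂ : ℤ → ℤ} (hσ₁ : IsHaggSeq σ₁) (hσ₂ : IsHaggSeq σ₂)
    (L₁ L₂ : EuclideanSpace ℝ (Fin 3) ≃ₗᵢ[ℝ] EuclideanSpace ℝ (Fin 3)) (s₀ s₂ : EuclideanSpace ℝ (Fin 3))
    (R₀ h ρ : ℝ) (hR₀ : 6 ≤ R₀) (hh : 0 ≤ h) (hρ : 1 ≤ ρ) (P₁ P₂ : Finset (EuclideanSpace ℝ (Fin 3))) (hP₁X : P₁ ⊆ X) (hP₂X : P₂ ⊆ X)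
    (hcell : ∀ p ∈ X, -(2 * R₀) ≤ p 2 ∧ p 2 ≤ h + 2 * R₀ ∧ p 0 ^ 2 + p 1 ^ 2 ≤ ρ ^ 2)
    (hP₁ : ∀ p, p ∈ P₁ ↔ (p ∈ stacking L₁ s₀ σ₁ ∧ -(2 * R₀) ≤ p 2 ∧ p 2 ≤ -R₀ ∧ p 0 ^ 2 + p 1 ^ 2 ≤ ρ ^ 2))
    (hP₂ : ∀ p, p ∈ P₂ ↔ (p ∈ stacking L₂ s₂ σ₂ ∧ h + R₀ ≤ p 2 ∧ p 2 ≤ h + 2 * R₀ ∧ p 0 ^ 2 + p 1 ^ 2 ≤ ρ ^ 2))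
    -- the steering and the bottom walk data
    {z : EuclideanSpace ℝ (Fin 3)} (hz : ‖z‖ = 1) (hze : ‖z - EuclideanSpace.single (2 : Fin 3) (1 : ℝ)‖ ≤ 1 / 3)
    (v₁ : EuclideanSpace ℝ (Fin 3)) (canon₁ : ℤ → EuclideanSpace ℝ (Fin 3) → EuclideanSpace ℝ (Fin 3) × List WalkEntry)
    (ms₁ : ℤ → EuclideanSpace ℝ (Fin 3))
    (hv₁ : v₁ ∈ fccSlots) (hv₁2 : v₁ 2 = Real.sqrt (2 / 3))
    (hsteep₁ : Real.sqrt 2 / 2 ≤ ⟪L₁ v₁, z⟫_ℝ)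
    (hcanon₁₁ : ∀ m t, σ₁ (m - 1) = 1 → canon₁ m t = (t, [⟨L₁, v₁, 0⟩]))
    (hcanon₁₂ : ∀ m t, σ₁ (m - 1) = -1 → canon₁ m t =
      (t, [⟨twinFrame L₁ (L₁ (EuclideanSpace.single (2 : Fin 3) (1 : ℝ))),
            bestCapper (twinFrame L₁ (L₁ (EuclideanSpace.single (2 : Fin 3) (1 : ℝ)))) (L₁ (EuclideanSpace.single (2 : Fin 3) (1 : ℝ))) z,
            L₁ (EuclideanSpace.single (2 : Fin 3) (1 : ℝ))⟩, ⟨L₁, v₁, 0⟩]))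
    (hms₁₁ : ∀ m, σ₁ m = 1 → ms₁ m = v₁)
    (hms₁₂ : ∀ m, σ₁ m = -1 → ms₁ m =
      basalMirror (bestCapper (twinFrame L₁ (L₁ (EuclideanSpace.single (2 : Fin 3) (1 : ℝ)))) (L₁ (EuclideanSpace.single (2 : Fin 3) (1 : ℝ))) z))
    {δ₁ : ℝ} (hδ₁0 : 0 < δ₁) (hδ₁ : ∀ m, δ₁ ≤ ⟪L₁ (ms₁ m), EuclideanSpace.single (2 : Fin 3) (1 : ℝ)⟫_ℝ)
    -- frames apart from the top plate (clause (i) of `FramesApart`, for THIS family only)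
    (hapart₁ : ∀ F ∈ chainFrames z L₁ v₁,
      F '' fccStacking 1 (Real.sqrt (2 / 3)) ≠ L₂ '' fccStacking 1 (Real.sqrt (2 / 3)) ∧
      F '' fccStacking 1 (Real.sqrt (2 / 3)) ≠
        (twinFrame L₂ (L₂ (EuclideanSpace.single (2 : Fin 3) (1 : ℝ)))) '' fccStacking 1 (Real.sqrt (2 / 3)))
    -- the window family
    (H₁ ρin : ℝ) (hH₁lo : -(2 * R₀) + 2 ≤ H₁) (hH₁hi : H₁ ≤ -R₀ - 3)
    (hρin₁ : ρin + 24 * (h + 4 * R₀) + ((-R₀ - 2 - H₁) / δ₁ + 2) ≤ ρ - 1)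
    {ι₁ : Type*} (T₁ : Finset ι₁) (m₁ a₁ b₁ : ι₁ → ℤ)
    (hlow₁ : ∀ i ∈ T₁, H₁ ≤ ⟪L₁ (barlowPos 1 (Real.sqrt (2 / 3)) σ₁ (m₁ i) (a₁ i) (b₁ i)) + s₀, EuclideanSpace.single (2 : Fin 3) (1 : ℝ)⟫_ℝ)
    (hpred₁ : ∀ i ∈ T₁, ⟪L₁ (barlowPos 1 (Real.sqrt (2 / 3)) σ₁ (m₁ i) (a₁ i) (b₁ i) - ms₁ (m₁ i - 1)) + s₀,
      EuclideanSpace.single (2 : Fin 3) (1 : ℝ)⟫_ℝ < H₁)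
    (hinjT₁ : ∀ i ∈ T₁, ∀ j ∈ T₁,
      barlowPos 1 (Real.sqrt (2 / 3)) σ₁ (m₁ i) (a₁ i) (b₁ i) = barlowPos 1 (Real.sqrt (2 / 3)) σ₁ (m₁ j) (a₁ j) (b₁ j) → i = j)
    (hlat₁ : ∀ i ∈ T₁, Real.sqrt ((L₁ (barlowPos 1 (Real.sqrt (2 / 3)) σ₁ (m₁ i) (a₁ i) (b₁ i)) + s₀) 0 ^ 2 +
      (L₁ (barlowPos 1 (Real.sqrt (2 / 3)) σ₁ (m₁ i) (a₁ i) (b₁ i)) + s₀) 1 ^ 2) ≤ ρin)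
    -- fuel
    {N : ℕ} (hN₁ : ⌈(-R₀ - 2 - H₁) / δ₁⌉₊ + 1 ≤ N) (hN₂ : 24 * (h + 4 * R₀) < (N : ℝ))
    (hN₃ : 8 * (h + 4 * R₀) + 6 * (ρ + h + 2 * R₀) < 3 * (N : ℝ)) :
    (T₁.card : ℝ) ≤
      ∑ y ∈ X.filter (fun y => (X.filter fun q => dist y q = 1).card ≠ 12 ∧ -R₀ - 2 ≤ y 2 ∧ y 2 ≤ h + R₀ + 2),
        ((12 : ℝ) - ((X.filter fun q => dist y q = 1).card : ℝ)) := by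
  set e₃ : EuclideanSpace ℝ (Fin 3) := EuclideanSpace.single (2 : Fin 3) (1 : ℝ) with he₃
  have he₃n : ‖e₃‖ = 1 := by rw [he₃, PiLp.norm_single, norm_one]
  have hztn : ‖-e₃‖ = 1 := by rw [norm_neg, he₃n]
  have he₃i : ∀ d : EuclideanSpace ℝ (Fin 3), ⟪d, e₃⟫_ℝ = d 2 := fun d => by rw [he₃, EuclideanSpace.inner_single_right]; simp
  have hez : ‖e₃ - z‖ ≤ 1 / 3 := by rw [norm_sub_rev]; exact hze
  obtain ⟨hB, hinjB⟩ := bottomFamily_spec_apart_tiltWide σ₁ L₁ s₀ z v₁ canon₁ ms₁ hσ₁ hX hsE hcert hσ₂ L₂ s₂ R₀ h ρ hR₀ hh hρ P₁ P₂ hP₁X hP₂X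
    hcell hP₁ hP₂ hz hze hv₁ hv₁2 hsteep₁ hcanon₁₁ hcanon₁₂ hms₁₁ hms₁₂ hδ₁0 hδ₁ hapart₁ H₁ ρin hH₁lo hH₁hi hρin₁ T₁ m₁ a₁ b₁ hlow₁ hpred₁
    hinjT₁ hlat₁ hN₁ hN₂
  set st₁ : ι₁ → EuclideanSpace ℝ (Fin 3) × List WalkEntry :=
    fun i => canon₁ (m₁ i) (L₁ (barlowPos 1 (Real.sqrt (2 / 3)) σ₁ (m₁ i) (a₁ i) (b₁ i)) + s₀) with hst₁
  -- the EMPTY second family: bottom entry `⟨L₁, 0, 0⟩` (no sound stack has it), frame set `∅`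
  set st₂ : Unit → EuclideanSpace ℝ (Fin 3) × List WalkEntry := fun _ => (0, []) with hst₂
  -- the `z`-height bound of the cell and the per-start fuel
  set Hz : ℝ := h + 2 * R₀ + (ρ + h + 2 * R₀) / 3 with hHz
  have hnorm : ∀ q ∈ X, ‖q‖ ≤ ρ + h + 2 * R₀ := fun q hq =>
    norm_le_of_mem_cyl (by linarith) hh (by linarith) (hcell q hq)
  have hH₁ : ∀ q ∈ X, ⟪q, z⟫_ℝ ≤ Hz := by
    intro q hq
    have h1 := inner_ref_ge_of_tilt_wide hze q
    rw [he₃i] at h1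
    have h2 := (hcell q hq).2.1
    have h3 := hnorm q hq
    rw [hHz]; linarith
  have hfuel : ∀ q ∈ X, 8 * (Hz - ⟪q, z⟫_ℝ) < 3 * N := by
    intro q hq
    have h1 := inner_ref_ge_of_tilt_wide hez q
    rw [he₃i] at h1
    have h2 := (hcell q hq).1
    have h3 := hnorm q hq
    rw [hHz]; linarith
  have hH₂ : ∀ q ∈ X, ⟪q, -e₃⟫_ℝ ≤ 2 * R₀ := fun q hq => by rw [inner_neg_right, he₃i]; linarith [(hcell q hq).1]
  have hM₁ : ∀ stk : List WalkEntry, StackSound z stk → StackWF z stk → stk.getLast? = some ⟨L₁, v₁, 0⟩ →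
      ∀ e ∈ stk, e.frame ∈ chainFrames z L₁ v₁ := fun stk hS hWF hl => frame_mem_chainFrames_of_stack hS hWF hl
  have hM₂ : ∀ stk : List WalkEntry, StackSound (-e₃) stk → StackWF (-e₃) stk → stk.getLast? = some ⟨L₁, 0, 0⟩ →
      ∀ e ∈ stk, e.frame ∈ (∅ : Set (EuclideanSpace ℝ (Fin 3) ≃ₗᵢ[ℝ] EuclideanSpace ℝ (Fin 3))) := by
    intro stk hS _ hl
    have h0 : (0 : EuclideanSpace ℝ (Fin 3)) ∈ fccSlots := stackSound_getLast_dir_mem (-e₃) stk ⟨L₁, 0, 0⟩ hS hl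
    have := norm_eq_one_of_mem_fccSlots h0
    rw [norm_zero] at this
    exact absurd this zero_ne_one
  have hbb : (⟨L₁, v₁, 0⟩ : WalkEntry) ≠ ⟨L₁, 0, 0⟩ := by
    intro hb
    have hv : v₁ = 0 := congrArg WalkEntry.dir hb
    have := norm_eq_one_of_mem_fccSlots hv₁
    rw [hv, norm_zero] at this
    exact zero_ne_one this
  have hsep : ∀ F₁ ∈ chainFrames z L₁ v₁, ∀ F₂ ∈ (∅ : Set (EuclideanSpace ℝ (Fin 3) ≃ₗᵢ[ℝ] EuclideanSpace ℝ (Fin 3))),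
      ¬ ∃ (L : EuclideanSpace ℝ (Fin 3) ≃ₗᵢ[ℝ] EuclideanSpace ℝ (Fin 3)) (t₁ t₂ : EuclideanSpace ℝ (Fin 3)) (σ σ' : ℤ → ℤ),
        IsHaggSeq σ ∧ IsHaggSeq σ' ∧
        F₁ '' fccStacking 1 (Real.sqrt (2 / 3)) ⊆ (fun p => L p + t₁) '' barlowStacking 1 (Real.sqrt (2 / 3)) σ ∧
        F₂ '' fccStacking 1 (Real.sqrt (2 / 3)) ⊆ (fun p => L p + t₂) '' barlowStacking 1 (Real.sqrt (2 / 3)) σ' :=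
    fun _ _ _ hF₂ => absurd hF₂ (Set.notMem_empty _)
  have hcount := walkerFamilies_card_le_payers_sep hX hsE hcert hDS hCP (chainFrames z L₁ v₁) ∅ hsep hz hztn hH₁ hH₂
    T₁ (∅ : Finset Unit) st₁ st₂ hbb N hM₁ hM₂ (fun t ht => ?_) (fun t ht => absurd ht (Finset.notMem_empty _)) hinjB
    (fun t ht => absurd ht (Finset.notMem_empty _)) _ (fun t ht => (hB t ht).2.2.2.2)
    (fun t ht => absurd ht (Finset.notMem_empty _))
  · simpa only [Finset.card_empty, Nat.cast_zero, add_zero] using hcount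
  · obtain ⟨hI, hW, hl, hC, -⟩ := hB t ht
    exact ⟨hI, hW, hl, hC, hfuel _ hI.1⟩

end Summit.Ventures.Crystal3D.Theorems

end
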